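import Summits.HodgeConjecture.HodgeConjecture.Theses.MarkmanPartnerTransport

/-!
# Route MarkmanPartnerTransport · assembly (stmt-HodgeConjecture-19656) — the trichotomy case split

`Assembly : PartnerTransport → IsometrySpannedThird → PicardThreeK3Squares → LowPicardRealMultiplication →
PartnerExistence → SectorComplement → HodgeConjecture` is pure logic: `SectorComplement` reduces the
summit to the marked `K3^{[2]}`-type sector `K3Sq2TypeHodge`; for a marked `(X, φ, P, z)` either the
transcendental Hodge endomorphisms are spanned by isometries (`IsometrySpannedThird`), or not and
`ρ(X) ≤ 3` (`LowPicardRealMultiplication`), or not and `ρ(X) ≥ 4`: then `PartnerExistence` supplies a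
marked projective K3 partner `S` with a transcendental Hodge isometry `g` and `ρ(S) ≥ 3`,
`PicardThreeK3Squares` gives `HC⁴(S ⊗ S)`, and `PartnerTransport` transports it to `HC⁴(X)`.  The `let`
binders of the six route declarations are textually identical, so the case split elaborates as stated.

* `markmanPartnerTransport_assembly_proof : Theses.MarkmanPartnerTransport.Assembly`.

No definition, no sorry, no named fact. Prover seat hodge-nonav-19652-p1 (gen 5).
-/

set_option linter.dupNamespace false

namespace Summit.HodgeConjecture.HodgeConjecture.Theorems

/-- **The assembly of route MarkmanPartnerTransport** (trichotomy case split, module docstring).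
[cite: Zarhin1983HodgeGroupsK3, Thm. 1.5.1] [cite: Markman2024, Thm. 1.1] -/
theorem markmanPartnerTransport_assembly_proof :
    Summit.HodgeConjecture.HodgeConjecture.Theses.MarkmanPartnerTransport.Assembly := by
  intro hPT hIS hP3 hLP hPE hSC
  refine hSC fun X hX hK φ P z hM => ?_
  refine Classical.byCases (hIS X hX hK φ P z hM) fun hspan => ?_
  by_cases hρ : Module.finrank ℂ ↥(Literature.AlgebraicGeometry.HodgeTheory.algebraicClasses X 1) ≤ 3
  · exact hLP X hX hK φ P z hM hspan hρ
  · obtain ⟨S, η, p, x, g, hS, hMk, hg, hρS⟩ := hPE X hX hK φ P z hM (by omega)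
    exact hPT X hX hK φ P z hM S hS η p x hMk g hg (hP3 S hS η p x hMk hρS)

end Summit.HodgeConjecture.HodgeConjecture.Theorems
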